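import Summits.HodgeConjecture.CorCM.Census.TwentyFourCyclicGrowth
import Summits.HodgeConjecture.CorCM.Census.TwentyFourCyclicMinimality

/-!
# Degree-24 atlas, type `ℤ/24` (sequel): the LATTICE THEOREM `H = P + A` and the deficiency `μ(ℤ/24) = 171` (kernel census)

COR-CM (cell `pub-hodgecm2`), count-neutral kernel census by the literature seat lit-andre-3 (gen 16; claim TWENTYFOUR-ATLAS), sequel of
`Census/TwentyFourCyclicGrowth.lean` and `Census/TwentyFourCyclicMinimality.lean`; statements and method VERBATIM
`Census/IcosicCyclicLattice.lean` (b17's modular law): the starting twelvefold `B₁₆₉` SPANS ALONE — its `12 × 12` Pohlmann sign matrix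
`M τ j = hodgeVec τ (q 169 j)` (`τ, j < 12`) has an integer adjugate certificate `adj · M = 2048 · 1` (`det M = ±2^{11}`), so a Hodge vector
supported on the twelve pair representatives of `B₁₆₉` vanishes (`hodge_inf_B169r_eq_bot`); with `W_eq_top` of the Growth file,
**`lattice_theorem_twentyfour`**: `H = P ⊔ A` — the Galois translates of the `171` face monomials of `Census/TwentyFourCyclicFaces.lean`
generate the Hodge lattice of the whole `F`-slice modulo divisor classes — and with `le_card_of_generates_171`,
**`deficiency_twentyfour_171`**: `μ(ℤ/24) = μ_faces(ℤ/24) = 171` exactly, attained by rank-four faces (oracle: `= dim_{𝔽₂}(H/P ⊗ 𝔽₂)_G`,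
`= #blocks − 1`).  No named fact, no `sorry`.  HC_CM is not proved anywhere in this cell; nothing here is a headline.

INT-2 READING (informal, the census lane's convention): for a cyclic CM field `F` of degree `24`, non-vanishing face periods on ONE face in
each of the `171` Galois orbits `orbitRep` is exactly what the period route needs to reach every Hodge class on every abelian variety
isogenous to a product of powers of the `172` simple factors split by `F`; no family of fewer than `171` Galois orbits of ANY Hodge
monomials suffices.

## References
* [Pohlmann1968] H. Pohlmann, Algebraic cycles on abelian varieties of complex multiplication type, Ann. of Math. 88 (1968), Thm 1.
* [Milne1999] J. S. Milne, Lefschetz motives and the Tate conjecture, Compositio Math. 117 (1999), Prop. 2.1, p. 54.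
-/

namespace Summit.HodgeConjecture.CorCM.Census.TwentyFourCyclicSpecies

open Finset

/-! ## `H ⊓ ℤ^{B₁₆₉⁺} = ⊥`: the adjugate certificate of the starting block -/

/-- Integer adjugate certificate of the `12 × 12` Pohlmann sign matrix `M τ j = hodgeVec τ (q 169 j)` (`τ, j < 12`) of `B₁₆₉`:
`adj · M = 2048 · 1` (`|det M| = 2^{11}`: `B₁₆₉` "spans alone"). [folklore] -/
def adj : Fin 12 → Fin 12 → ℤ :=
  ![![1024, 0, 0, 0, 0, 0, 0, 0, 0, 0, 0, 1024],
    ![0, 0, 0, 0, 0, 0, 0, 0, 0, 0, 1024, -1024],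
    ![0, 0, 0, 0, 0, 0, 0, 0, 0, 1024, -1024, 0],
    ![0, 0, 0, 0, 0, 0, 0, 0, 1024, -1024, 0, 0],
    ![0, 0, 0, 0, 0, 0, 0, 1024, -1024, 0, 0, 0],
    ![0, 0, 0, 0, 0, 0, 1024, -1024, 0, 0, 0, 0],
    ![0, 0, 0, 0, 0, 1024, -1024, 0, 0, 0, 0, 0],
    ![0, 0, 0, 0, 1024, -1024, 0, 0, 0, 0, 0, 0],
    ![0, 0, 0, 1024, -1024, 0, 0, 0, 0, 0, 0, 0],
    ![0, 0, 1024, -1024, 0, 0, 0, 0, 0, 0, 0, 0],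
    ![0, 1024, -1024, 0, 0, 0, 0, 0, 0, 0, 0, 0],
    ![1024, -1024, 0, 0, 0, 0, 0, 0, 0, 0, 0, 0]]

set_option maxRecDepth 100000 in set_option maxHeartbeats 4000000 in
/-- `adj · M = 2048 · 1`. [folklore] -/
theorem adj_mul : ∀ i j : Fin 12, ∑ t : Fin 12, adj i t * hodgeVec ((t : ℕ) : ZMod 24) (q 169 ((j : ℕ) : ZMod 24)) = if i = j then 2048 else 0 := by
  decide +kernel

/-- A Hodge vector supported on the twelve representatives of `B₁₆₉` is zero. [folklore] -/
theorem hodge_inf_B169r_eq_bot : hodgeLattice ⊓ B169r = ⊥ := by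
  refine (Submodule.eq_bot_iff _).mpr fun v hv => ?_
  obtain ⟨hH, hB⟩ := Submodule.mem_inf.mp hv
  obtain ⟨c, rfl⟩ := (Submodule.mem_span_range_iff_exists_fun ℤ).mp hB
  have hform : ∀ t : Fin 12, ∑ j : Fin 12, hodgeVec ((t : ℕ) : ZMod 24) (q 169 ((j : ℕ) : ZMod 24)) * c j = 0 := by
    intro t
    have h := hH ((t : ℕ) : ZMod 24)
    rw [dotProduct_sum] at h
    simp only [dotProduct_smul, dotProduct_ind, Finset.sum_singleton, smul_eq_mul] at h
    rw [← h]
    exact Finset.sum_congr rfl fun j _ => mul_comm _ _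
  have hc : ∀ i : Fin 12, c i = 0 := by
    intro i
    have h2048 : (2048 : ℤ) * c i = ∑ t : Fin 12, adj i t * ∑ j : Fin 12, hodgeVec ((t : ℕ) : ZMod 24) (q 169 ((j : ℕ) : ZMod 24)) * c j := by
      simp_rw [Finset.mul_sum, ← mul_assoc]
      rw [Finset.sum_comm]
      simp_rw [← Finset.sum_mul, adj_mul]
      simp only [ite_mul, zero_mul, Finset.sum_ite_eq, Finset.mem_univ, if_true]
    simp only [hform, mul_zero, Finset.sum_const_zero] at h2048
    omega
  simp only [hc, zero_smul, Finset.sum_const_zero]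

/-! ## The lattice theorem -/

/-- **LATTICE THEOREM (`ℤ/24`).**  The Hodge lattice of the whole `F`-slice of a cyclic CM field of degree `24` is generated by the divisor
classes and the Galois translates of the one hundred and seventy-one rank-four face monomials `orbitRep` of `Census/TwentyFourCyclicFaces.lean`:
`H = P ⊔ A`.  With `le_card_of_generates_171`: `μ(ℤ/24) = 171`, attained by faces. [folklore] -/
theorem lattice_theorem_twentyfour :
    (hodgeLattice : Submodule ℤ (Pt → ℤ)) = pairs ⊔ Submodule.span ℤ (Set.range fun p : ZMod 24 × Fin 171 => transl p.1 (atomVec p.2)) := by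
  refine le_antisymm ?_ (sup_le pairs_le atoms_le)
  intro v hv
  show v ∈ pairs ⊔ atoms
  have hPA : pairs ⊔ atoms ≤ hodgeLattice := sup_le pairs_le atoms_le
  have htop : (⊤ : Submodule ℤ (Pt → ℤ)) ≤ B169r ⊔ (pairs ⊔ atoms) := by
    rw [← W_eq_top, W]
    exact sup_le (B169_le.trans (sup_le_sup_left le_sup_left _)) le_sup_right
  obtain ⟨b, hb, w, hw, hbw⟩ := Submodule.mem_sup.mp (htop (Submodule.mem_top : v ∈ ⊤))
  have hbH : b ∈ hodgeLattice := by
    have e : b = v - w := eq_sub_of_add_eq hbw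
    rw [e]
    exact Submodule.sub_mem _ hv (hPA hw)
  have hb0 : b = 0 := (Submodule.mem_bot ℤ).mp (hodge_inf_B169r_eq_bot ▸ Submodule.mem_inf.mpr ⟨hbH, hb⟩)
  rw [← hbw, hb0, zero_add]
  exact hw

/-- **`μ(ℤ/24) ≤ 171` in the form used by the minimality statement**: the Hodge lattice is generated, modulo pairs, by the translates of the
finite family of the `171` face monomials. [folklore] -/
theorem hodgeLattice_le_span_faces_171 :
    hodgeLattice ≤ pairs ⊔ Submodule.span ℤ {v | ∃ g : ZMod 24, ∃ t ∈ (univ.image atomVec : Finset (Pt → ℤ)), v = transl g t} := by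
  rw [lattice_theorem_twentyfour]
  refine sup_le_sup_left (Submodule.span_le.mpr ?_) _
  rintro _ ⟨p, rfl⟩
  exact Submodule.subset_span ⟨p.1, atomVec p.2, Finset.mem_image_of_mem _ (Finset.mem_univ _), rfl⟩

/-- **DEFICIENCY `μ(ℤ/24) = 171`, attained by rank-four faces.**  The family of the `171` face monomials generates the Hodge lattice modulo
pairs under translation and has at most `171` members, and every generating family has at least `171` members. [folklore] -/
theorem deficiency_twentyfour_171 :
    (hodgeLattice ≤ pairs ⊔ Submodule.span ℤ {v | ∃ g : ZMod 24, ∃ t ∈ (univ.image atomVec : Finset (Pt → ℤ)), v = transl g t} ∧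
      (univ.image atomVec : Finset (Pt → ℤ)).card ≤ 171) ∧
    ∀ S : Finset (Pt → ℤ), hodgeLattice ≤ pairs ⊔ Submodule.span ℤ {v | ∃ g : ZMod 24, ∃ t ∈ S, v = transl g t} → 171 ≤ S.card :=
  ⟨⟨hodgeLattice_le_span_faces_171, Finset.card_image_le.trans (by simp)⟩, le_card_of_generates_171⟩

end Summit.HodgeConjecture.CorCM.Census.TwentyFourCyclicSpecies
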